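import Summits.BirchSwinnertonDyer.BirchSwinnertonDyer.Theses.CMKolyvaginAtInertTwo
import Summits.BirchSwinnertonDyer.Rank1Residual.Partition.MainConjecturesCMInert
import Literature.NumberTheory.EllipticCurves.HeegnerPointsOfConductor
import Literature.NumberTheory.EllipticCurves.ModularityVersionApProofs
import Literature.NumberTheory.EllipticCurves.IsogenyHasCMIffJMemProofs
import Literature.NumberTheory.EllipticCurves.Rank1Residual.CMFieldDecompositionProofs
import Literature.NumberTheory.QuadraticFields.DiscriminantCharacter
import Literature.NumberTheory.QuadraticFields.RingClassNumberFormula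
import Literature.NumberTheory.QuadraticFields.HeegnerCondition
import HarnessLib

/-!
# Kolyvagin primes at `p = 2` of EVERY depth for CM curves — "deep Kolyvagin primes for free"
# (route CMKolyvaginAtInertTwo, thesis clause (iii); supply for cruxes 22835 / 22836)

Seat `bsd-line-cmk2-p1` g2 (cell `bsd-print-cf2`), route `route-BirchSwinnertonDyer-CMKolyvaginAtInertTwo`.
Summit-side THEOREM-ONLY file (no definition, no named fact, no `sorry`).

The route's cruxes `CMPrimitiveSupplyAtInertTwo` (stmt 22835) and `CMKolyvaginExactAtInertTwo`
(stmt 22836) quantify over square-free products `n` of **Kolyvagin primes at `2`**,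
`Zhang2014.IsKolyvaginPrime (W.conductorNorm ℤ) W K 2 ℓ` (`ℓ` prime, `ℓ ∤ N`, `ℓ ∤ d_K`, `ℓ ≠ 2`,
`(ℓ)` prime in `𝓞 K`, `M(ℓ) = v₂(gcd(ℓ + 1, |a_ℓ|)) > 0`), and the thesis claims (rationale, (iii)):
*"a_ℓ = 0 for every ℓ inert in F, so the Kolyvagin index M(ℓ) = v₂(ℓ+1) is unbounded on a set of
primes of Dirichlet density — deep Kolyvagin primes for free, where a non-CM curve needs Chebotarev in a
2-adic Lie image"*. This file proves exactly that, for EVERY CM curve `W/ℚ` (any of the thirteen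
`j`-invariants, globally minimal model so that `a_ℓ = W.frobeniusTrace ℓ`) and EVERY imaginary quadratic
`K`, with no hypothesis at `2` and no parity hypothesis on `d_K`:

* §1 `legendreSym_eq_neg_one_of_natCast_eq_neg_one` — for a negative discriminant `D` and an odd prime
  `ℓ ≡ −1 (mod |D|)`: `(D/ℓ) = −1` (Cox's character `χ_D` has `χ_D(−1) = −1` for `D < 0`, Lemma 1.14 /
  Ex. 1.12; tree `Quadratic.discrChar_neg_one`, `discrChar_natCast_prime`).
* §2 `isPrime_span_of_natCast_discr_eq_neg_one` — such an `ℓ` is INERT in `K = ℚ(√d_K)` and `ℓ ∤ d_K`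
  (tree `RingClass.isPrime_span_natCast_iff_jacobiSym_eq_neg_one`, Cox Prop. 5.16).
* §3 `cmInert_of_natCast_cmFieldDiscr_eq_neg_one` — `ℓ ≡ −1 (mod |d_F|)` is inert in the CM field `F`
  (`Rank1Residual.CMInert W ℓ`), hence `a_ℓ(W) = 0` at good `ℓ` (Deuring; tree
  `Rank1Residual.frobeniusTrace_eq_zero_of_hasCM_of_cmInert`).
* §4 `isKolyvaginPrime_two_of_natCast_eq_neg_one` — every prime `ℓ > N` with
  `ℓ ≡ −1 (mod 4·|d_K|·|d_F|)` is a Kolyvagin prime at `2` with `a_ℓ = 0` and `M(ℓ) = v₂(ℓ + 1)`.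
* §5 `exists_isKolyvaginPrime_two_depth` / `setOf_isKolyvaginPrime_two_depth_infinite` — for every `M`
  there are infinitely many (beyond any bound) Kolyvagin primes `ℓ` at `2` with `2^M ∣ ℓ + 1`, `a_ℓ = 0`,
  `M ≤ M(ℓ)`: Dirichlet's theorem (Mathlib `Nat.forall_exists_prime_gt_and_eq_mod`) in the single
  class `ℓ ≡ −1 (mod 2^M·4·|d_K|·|d_F|)`.

HONEST FRAMING. This is the EASY half of the supply crux 22835 (existence and depth of Kolyvagin primes);
the hard half (a derived point `P(n) ∉ 2E(K[n])`, Gross's Question 11 at `2`) and the exactness crux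
22836 are untouched. No item is closed; BSD is not proved by any of this; beyond-print theorem: no
(Deuring + Dirichlet), but the statement at `p = 2` for CM curves is not in print as such.

References: [Cox2013] D. A. Cox, *Primes of the form x² + ny²*, 2nd ed., §1.C Lemma 1.14, §5.B
Prop. 5.16; [Lang1987] S. Lang, *Elliptic Functions*, Ch. 13 §4 Thm. 12 (Deuring); [GrossLMS1991]
B. H. Gross, *Kolyvagin's work on modular elliptic curves*, §3 (3.1)–(3.3); [WZhang2014] W. Zhang,
Camb. J. Math. 2 (2014), Notations (xii); Dirichlet's theorem (Mathlib `PrimesInAP`).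
-/

set_option autoImplicit false
set_option linter.dupNamespace false

noncomputable section

open scoped Classical

namespace Summit.BirchSwinnertonDyer.BirchSwinnertonDyer.Theorems.CMKolyvaginPrimes

open WeierstrassCurve NumberField
open Literature.NumberTheory.EllipticCurves
open Literature.NumberTheory.EllipticCurves.Rank1Residual
open Literature.NumberTheory.QuadraticFields

/-! ### §1 `ℓ ≡ −1 (mod |D|)` for a negative discriminant `D`: `(D/ℓ) = −1` -/

/-- Casting `ℓ ≡ −1` down a divisor of the modulus. [folklore] -/
theorem natCast_eq_neg_one_of_dvd {m d ℓ : ℕ} (hd : d ∣ m) (h : (ℓ : ZMod m) = -1) :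
    (ℓ : ZMod d) = -1 := by
  have h' := congrArg (ZMod.castHom hd (ZMod d)) h
  rwa [map_natCast, map_neg, map_one] at h'

/-- `ℓ ≡ −1 (mod m)` with `k ∣ m` gives `k ∣ ℓ + 1`. [folklore] -/
theorem dvd_add_one_of_natCast_eq_neg_one {m k ℓ : ℕ} (hk : k ∣ m) (h : (ℓ : ZMod m) = -1) :
    k ∣ ℓ + 1 := by
  have h' : ((ℓ + 1 : ℕ) : ZMod k) = 0 := by
    push_cast
    rw [natCast_eq_neg_one_of_dvd hk h, neg_add_cancel]
  exact (ZMod.natCast_eq_zero_iff _ _).mp h'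

/-- **For a negative discriminant `D` (`D ≡ 0, 1 (mod 4)`) and an odd prime `ℓ ≡ −1 (mod |D|)`,
`(D/ℓ) = −1`**: Cox's character `χ_D : (ℤ/D)ˣ → {±1}` takes the value `(D/ℓ)` on `[ℓ]` (Lemma 1.14)
and `χ_D(−1) = −1` for `D < 0` (Ex. 1.12). [cite: Cox2013, §1.C Lemma 1.14 and Exercise 1.12] -/
theorem legendreSym_eq_neg_one_of_natCast_eq_neg_one {D : ℤ} (hD : D < 0)
    (hD4 : D % 4 = 0 ∨ D % 4 = 1) {ℓ : ℕ} [Fact ℓ.Prime] (hℓ2 : ℓ ≠ 2)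
    (h : (ℓ : ZMod D.natAbs) = -1) : legendreSym ℓ D = -1 := by
  have hu : (ℓ : ZMod D.natAbs) = ((-1 : (ZMod D.natAbs)ˣ) : ZMod D.natAbs) := by
    rw [h, Units.val_neg, Units.val_one]
  have h1 := Quadratic.discrChar_natCast_prime hD.ne hD4 hℓ2 hu
  rw [Quadratic.discrChar_neg_one hD hD4, Units.val_neg, Units.val_one] at h1
  exact h1.symm

/-- `(D/ℓ) = −1` forces `ℓ ∤ D`. [folklore] -/
theorem not_dvd_of_legendreSym_eq_neg_one {D : ℤ} {ℓ : ℕ} [Fact ℓ.Prime]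
    (h : legendreSym ℓ D = -1) : ¬ (ℓ : ℤ) ∣ D := by
  intro hdvd
  have h0 : legendreSym ℓ D = 0 := (legendreSym.eq_zero_iff ℓ D).mpr (by
    rw [ZMod.intCast_zmod_eq_zero_iff_dvd]; exact hdvd)
  rw [h0] at h
  exact absurd h (by norm_num)

/-! ### §2 Inert in the Heegner field `K` -/

/-- **An odd prime `ℓ ≡ −1 (mod |d_K|)` is inert in an imaginary quadratic `K` and `ℓ ∤ d_K`**
(`(d_K/ℓ) = −1`, Cox Prop. 5.16). [cite: Cox2013, §5.B Prop. 5.16, p. 105] -/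
theorem isPrime_span_of_natCast_discr_eq_neg_one {K : Type} [Field K] [NumberField K]
    (hK : IsImaginaryQuadratic K) {ℓ : ℕ} (hℓ : ℓ.Prime) (hℓ2 : ℓ ≠ 2)
    (h : (ℓ : ZMod (NumberField.discr K).natAbs) = -1) :
    (Ideal.span {(ℓ : 𝓞 K)}).IsPrime ∧ ¬ ((ℓ : ℤ) ∣ NumberField.discr K) := by
  haveI := Fact.mk hℓ
  have hleg : legendreSym ℓ (NumberField.discr K) = -1 :=
    legendreSym_eq_neg_one_of_natCast_eq_neg_one hK.discr_neg (Quadratic.discr_emod_four hK.1) hℓ2 h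
  refine ⟨(RingClass.isPrime_span_natCast_iff_jacobiSym_eq_neg_one hK.1 hℓ hℓ2).mpr ?_,
    not_dvd_of_legendreSym_eq_neg_one hleg⟩
  rw [← jacobiSym.legendreSym.to_jacobiSym]
  exact hleg

/-! ### §3 Inert in the CM field `F`: `CMInert W ℓ`, hence `a_ℓ = 0` -/

variable (W : WeierstrassCurve ℚ) [W.IsElliptic]

/-- For a CM curve, `d_F = cmFieldDiscrOfJ j(W)` is a negative discriminant (one of
`−3, −4, −7, −8, −11, −19, −43, −67, −163`). [cite: SilvermanATAEC1994, App. A §3] -/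
theorem cmFieldDiscrOfJ_neg_and_emod_four (hCM : W.HasCM) :
    cmFieldDiscrOfJ W.j < 0 ∧ (cmFieldDiscrOfJ W.j % 4 = 0 ∨ cmFieldDiscrOfJ W.j % 4 = 1) := by
  have hj : W.j ∈ cmJInvariants := (hasCM_iff_j_mem_holds W).mp hCM
  have hmem := cmFieldDiscrOfJ_mem_of_mem_cmJInvariants hj
  simp only [Finset.mem_insert, Finset.mem_singleton] at hmem
  rcases hmem with h | h | h | h | h | h | h | h | h <;> rw [h] <;> decide

/-- **An odd prime `ℓ ≡ −1 (mod |d_F|)` is INERT in the CM field** (`CMInert W ℓ`: `ℓ ∤ d_F` and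
`d_F` is a non-square mod `ℓ`). [cite: Cox2013, §5.B Prop. 5.16, p. 105] -/
theorem cmInert_of_natCast_cmFieldDiscr_eq_neg_one (hCM : W.HasCM) {ℓ : ℕ} (hℓ : ℓ.Prime)
    (hℓ2 : ℓ ≠ 2) (h : (ℓ : ZMod (cmFieldDiscrOfJ W.j).natAbs) = -1) : CMInert W ℓ := by
  haveI := Fact.mk hℓ
  obtain ⟨hneg, h4⟩ := cmFieldDiscrOfJ_neg_and_emod_four W hCM
  have hleg : legendreSym ℓ (cmFieldDiscrOfJ W.j) = -1 :=
    legendreSym_eq_neg_one_of_natCast_eq_neg_one hneg h4 hℓ2 h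
  have hndvd := not_dvd_of_legendreSym_eq_neg_one hleg
  refine ⟨hndvd, ?_⟩
  rintro ⟨-, hsq⟩
  rw [if_neg hℓ2] at hsq
  exact (legendreSym.eq_neg_one_iff ℓ).mp hleg hsq

variable [W.IsGloballyMinimal]

/-- **Deuring at such a prime: `a_ℓ(W) = 0`** for a globally minimal CM curve at a good odd prime
`ℓ ≡ −1 (mod |d_F|)`. [cite: Lang1987, Ch. 13 §4 Thm. 12] -/
theorem frobeniusTrace_eq_zero_of_natCast_cmFieldDiscr_eq_neg_one (hCM : W.HasCM) {ℓ : ℕ}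
    [Fact ℓ.Prime] (hℓ2 : ℓ ≠ 2) (hgood : W.HasGoodReductionAtPrime ℓ)
    (h : (ℓ : ZMod (cmFieldDiscrOfJ W.j).natAbs) = -1) : W.frobeniusTrace ℓ = 0 :=
  Summit.BirchSwinnertonDyer.Rank1Residual.frobeniusTrace_eq_zero_of_hasCM_of_cmInert hCM hℓ2
    hgood (cmInert_of_natCast_cmFieldDiscr_eq_neg_one W hCM Fact.out hℓ2 h)

/-! ### §4 Kolyvagin primes at `2` -/

omit [W.IsElliptic] in
/-- With `a_ℓ = 0` the Kolyvagin index at `2` is `M(ℓ) = v₂(ℓ + 1)`. [cite: WZhang2014, Notations (xii)] -/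
theorem kolyvaginIndex_two_eq_of_frobeniusTrace_eq_zero {ℓ : ℕ} (h0 : W.frobeniusTrace ℓ = 0) :
    Zhang2014.kolyvaginIndex W 2 ℓ = padicValNat 2 (ℓ + 1) := by
  rw [Zhang2014.kolyvaginIndex, h0, Int.natAbs_zero, Nat.gcd_zero_right]

/-- **Every prime `ℓ > N` with `ℓ ≡ −1 (mod m)`, `4·|d_K|·|d_F| ∣ m`, is a Kolyvagin prime at `2`
for `(W, K)` with `a_ℓ = 0` and `M(ℓ) = v₂(ℓ + 1)`** (`W` CM, globally minimal; `K` imaginary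
quadratic; `N = N(W)`). [cite: GrossLMS1991, §3 (3.1)–(3.3)] [cite: WZhang2014, Notations (xii)] -/
theorem isKolyvaginPrime_two_of_natCast_eq_neg_one (hCM : W.HasCM) {K : Type} [Field K]
    [NumberField K] (hK : IsImaginaryQuadratic K) {m ℓ : ℕ}
    (hm : 4 * (NumberField.discr K).natAbs * (cmFieldDiscrOfJ W.j).natAbs ∣ m)
    (hℓ : ℓ.Prime) (hNℓ : W.conductorNorm ℤ < ℓ) (h : (ℓ : ZMod m) = -1) :
    Zhang2014.IsKolyvaginPrime (W.conductorNorm ℤ) W K 2 ℓ ∧ W.frobeniusTrace ℓ = 0 ∧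
      Zhang2014.kolyvaginIndex W 2 ℓ = padicValNat 2 (ℓ + 1) := by
  haveI := Fact.mk hℓ
  have h4 : (4 : ℕ) ∣ m := dvd_trans (dvd_mul_of_dvd_left (dvd_mul_right 4 _) _) hm
  have hK' : (NumberField.discr K).natAbs ∣ m :=
    dvd_trans (dvd_mul_of_dvd_left (dvd_mul_left _ 4) _) hm
  have hF' : (cmFieldDiscrOfJ W.j).natAbs ∣ m := dvd_trans (dvd_mul_left _ _) hm
  have hℓ4 : 4 ∣ ℓ + 1 := dvd_add_one_of_natCast_eq_neg_one h4 h
  have hℓ2 : ℓ ≠ 2 := by omega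
  have hNdvd : ¬ ℓ ∣ W.conductorNorm ℤ := fun hd ↦
    absurd (Nat.le_of_dvd W.conductorNorm_pos_holds hd) (not_le.mpr hNℓ)
  have hgood : W.HasGoodReductionAtPrime ℓ := by
    by_contra hbad
    exact hNdvd ((dvd_conductorNorm_iff_not_hasGoodReductionAtPrime (W := W) ℓ).mpr hbad)
  obtain ⟨hinert, hdK⟩ := isPrime_span_of_natCast_discr_eq_neg_one hK hℓ hℓ2
    (natCast_eq_neg_one_of_dvd hK' h)
  have ha : W.frobeniusTrace ℓ = 0 :=
    frobeniusTrace_eq_zero_of_natCast_cmFieldDiscr_eq_neg_one W hCM hℓ2 hgood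
      (natCast_eq_neg_one_of_dvd hF' h)
  have hidx := kolyvaginIndex_two_eq_of_frobeniusTrace_eq_zero W ha
  refine ⟨⟨hℓ, hNdvd, hdK, hℓ2, hinert, ?_⟩, ha, hidx⟩
  rw [hidx]
  have h2 : 2 ∣ ℓ + 1 := dvd_trans (by norm_num) hℓ4
  haveI : Fact (Nat.Prime 2) := ⟨Nat.prime_two⟩
  exact one_le_padicValNat_of_dvd (by omega) h2

/-! ### §5 Supply of every depth (Dirichlet) -/

/-- **Kolyvagin primes at `2` of every depth exist beyond any bound, for every CM curve and every
imaginary quadratic `K`**: for all `M, n` there is a prime `ℓ > n` with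
`IsKolyvaginPrime N(W) W K 2 ℓ`, `2^M ∣ ℓ + 1`, `a_ℓ = 0` and `M ≤ M(ℓ)` — Dirichlet's theorem in the
class `ℓ ≡ −1 (mod 2^M · 4|d_K| · |d_F|)`. [cite: Cox2013, §5.B Prop. 5.16] [cite: Lang1987, Ch. 13 §4 Thm. 12] -/
theorem exists_isKolyvaginPrime_two_depth (hCM : W.HasCM) {K : Type} [Field K] [NumberField K]
    (hK : IsImaginaryQuadratic K) (M n : ℕ) :
    ∃ ℓ : ℕ, n < ℓ ∧ Zhang2014.IsKolyvaginPrime (W.conductorNorm ℤ) W K 2 ℓ ∧ 2 ^ M ∣ ℓ + 1 ∧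
      W.frobeniusTrace ℓ = 0 ∧ M ≤ Zhang2014.kolyvaginIndex W 2 ℓ := by
  set m : ℕ := 2 ^ M * (4 * (NumberField.discr K).natAbs * (cmFieldDiscrOfJ W.j).natAbs) with hm_def
  have hdK0 : (NumberField.discr K).natAbs ≠ 0 := Int.natAbs_ne_zero.mpr (NumberField.discr_ne_zero K)
  have hdF0 : (cmFieldDiscrOfJ W.j).natAbs ≠ 0 :=
    Int.natAbs_ne_zero.mpr (cmFieldDiscrOfJ_neg_and_emod_four W hCM).1.ne
  have hm0 : m ≠ 0 := by positivity
  haveI : NeZero m := ⟨hm0⟩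
  obtain ⟨ℓ, hℓgt, hℓ, hℓm⟩ :=
    Nat.forall_exists_prime_gt_and_eq_mod (q := m) (a := -1) isUnit_one.neg (max n (W.conductorNorm ℤ))
  simp only [gt_iff_lt, max_lt_iff] at hℓgt
  obtain ⟨hK', ha, hidx⟩ := isKolyvaginPrime_two_of_natCast_eq_neg_one W hCM hK
    (dvd_mul_left _ _) hℓ hℓgt.2 hℓm
  have h2M : 2 ^ M ∣ ℓ + 1 := dvd_add_one_of_natCast_eq_neg_one (dvd_mul_right _ _) hℓm
  refine ⟨ℓ, hℓgt.1, hK', h2M, ha, ?_⟩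
  rw [hidx]
  haveI : Fact (Nat.Prime 2) := ⟨Nat.prime_two⟩
  exact (padicValNat_dvd_iff_le (by omega)).mp h2M

/-- **The set of Kolyvagin primes at `2` of depth `≥ M` is infinite** (same content, `Set.Infinite`
form). [cite: Cox2013, §5.B Prop. 5.16] [cite: Lang1987, Ch. 13 §4 Thm. 12] -/
theorem setOf_isKolyvaginPrime_two_depth_infinite (hCM : W.HasCM) {K : Type} [Field K]
    [NumberField K] (hK : IsImaginaryQuadratic K) (M : ℕ) :
    {ℓ : ℕ | Zhang2014.IsKolyvaginPrime (W.conductorNorm ℤ) W K 2 ℓ ∧ 2 ^ M ∣ ℓ + 1 ∧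
      W.frobeniusTrace ℓ = 0 ∧ M ≤ Zhang2014.kolyvaginIndex W 2 ℓ}.Infinite := by
  refine Set.infinite_of_forall_exists_gt fun n ↦ ?_
  obtain ⟨ℓ, hn, h⟩ := exists_isKolyvaginPrime_two_depth W hCM hK M n
  exact ⟨ℓ, h, hn⟩

/-- **On the route's habitat** (binders of `CMKolyvaginExactAtInertTwo` / `CMPrimitiveSupplyAtInertTwo`:
`W` CM with `2` inert in `F`, `K` imaginary quadratic): for every depth `M` a Kolyvagin prime `ℓ` at `2`
with `2^M ∣ ℓ + 1` and `2^M ∣ a_ℓ = 0` exists — the "Kolyvagin primes of ANY 2-adic depth exist by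
Dirichlet alone" clause of the thesis. (`CMInert W 2` is not used: the statement holds for all CM `W`.)
[cite: GrossLMS1991, §3 (3.3)] [cite: WZhang2014, Notations (xii)] -/
theorem exists_isKolyvaginPrime_two_of_cmInert (hCM : W.HasCM) (_hin : CMInert W 2) {K : Type}
    [Field K] [NumberField K] (hK : IsImaginaryQuadratic K) (M : ℕ) :
    ∃ ℓ : ℕ, Zhang2014.IsKolyvaginPrime (W.conductorNorm ℤ) W K 2 ℓ ∧ 2 ^ M ∣ ℓ + 1 ∧
      (2 : ℤ) ^ M ∣ W.frobeniusTrace ℓ := by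
  obtain ⟨ℓ, -, hK', h2M, ha, -⟩ := exists_isKolyvaginPrime_two_depth W hCM hK M 0
  exact ⟨ℓ, hK', h2M, by rw [ha]; exact dvd_zero _⟩

end Summit.BirchSwinnertonDyer.BirchSwinnertonDyer.Theorems.CMKolyvaginPrimes

end
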